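import Mathlib
import Summits.Schanuel.Schanuel.Theses.RigidCore
import Summits.Schanuel.Schanuel.Theorems.MinimalCounterexampleInAcl.Negative.FirstFailureEcl
import Literature.NumberTheory.Transcendental.ZilberFieldExistenceProofs

/-!
# stub-proved: `stub_mateFirstFailure` (line kernel-arithmetic-selection, skeleton f7f45f09face)

Evidence file from the crux disprover (cdisprove gen 3) for the lead of crux stmt-Schanuel-0969: the
THIRD registered stub of the PICKED line is a THEOREM — stated VERBATIM at the bottom
(`stub_mateFirstFailure_holds`) and proved sorry-free:

* first half (`mate_trdeg_lt'`): a locus mate of a counterexample tuple is a counterexample tuple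
  (relations transfer algebraic independence backwards: `algebraicIndependent_of_relations`; matroid-rank
  pull-back `natCast_le_trdeg_of_relations`) — proposed as `Negative/MateTrdeg.lean` (p73989);
* second half (`mate_relations_symm`, `mate_locus_eq`): the relation ideals of `(x, eˣ)` and
  `(x', e^{x'})` COINCIDE — prime ideals `P ⊆ P'` of `ℚ[X,Y]` with quotients of the same transcendence
  degree `n − 1` (`exists_indep_subfamily` from `SchanuelRank (n−1)` on the LI mate): lift an independent
  `(n−1)`-sub-family `v' ∘ f` to `v ∘ f`, make a putative non-relation `a = p(x,eˣ) ≠ 0` algebraic over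
  `ℚ[v ∘ f]` with non-zero constant term `g₀(v∘f)`, transport the relation `Σ (rename f gⱼ)·pʲ ∈ P ⊆ P'`
  to `(x', e^{x'})` where `p ↦ 0`: `g₀(v'∘f) = 0`, so `g₀ = 0`, contradiction.

To be landed as `Negative/MateLocus.lean` (importing `Negative/MateTrdeg.lean`) once p73989 is built.
-/

noncomputable section

set_option linter.dupNamespace false

open Complex Set
open Literature.NumberTheory.Transcendental
open Summit.Schanuel.Schanuel.Theorems.MinimalCounterexampleInAcl.Negative

namespace Summit.Schanuel.Schanuel.Cruxes.MinimalCounterexampleInAcl.StubsEvidence3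

/-- **Relations transfer algebraic independence backwards**: if `x'` satisfies every ℚ-relation of
`(x, eˣ)`, an algebraically independent sub-family of `(x', e^{x'})` is algebraically independent for
`(x, eˣ)` at the same indices. [folklore] -/
theorem algebraicIndependent_of_relations {n : ℕ} {x x' : Fin n → ℂ}
    (hrel : ∀ p : MvPolynomial (Fin n ⊕ Fin n) ℚ,
      MvPolynomial.aeval (Sum.elim x (cexp ∘ x)) p = 0 →
      MvPolynomial.aeval (Sum.elim x' (cexp ∘ x')) p = 0)
    {ι : Type*} (f : ι → Fin n ⊕ Fin n)
    (hind : AlgebraicIndependent ℚ (Sum.elim x' (cexp ∘ x') ∘ f)) :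
    AlgebraicIndependent ℚ (Sum.elim x (cexp ∘ x) ∘ f) := by
  rw [algebraicIndependent_iff] at hind ⊢
  intro P hP
  refine hind P ?_
  have h1 : MvPolynomial.aeval (Sum.elim x (cexp ∘ x)) (MvPolynomial.rename f P) = 0 := by
    rw [MvPolynomial.aeval_rename]; exact hP
  have h2 := hrel _ h1
  rwa [MvPolynomial.aeval_rename] at h2

/-- Hence the transcendence degree cannot go up along relations:
`m ≤ trdeg ℚ(x', e^{x'}) ⟹ m ≤ trdeg ℚ(x, eˣ)` for every natural `m`. [folklore] -/
theorem natCast_le_trdeg_of_relations {n : ℕ} {x x' : Fin n → ℂ}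
    (hrel : ∀ p : MvPolynomial (Fin n ⊕ Fin n) ℚ,
      MvPolynomial.aeval (Sum.elim x (cexp ∘ x)) p = 0 →
      MvPolynomial.aeval (Sum.elim x' (cexp ∘ x')) p = 0)
    {m : ℕ}
    (hm : (m : Cardinal) ≤ Algebra.trdeg ℚ ↥(IntermediateField.adjoin ℚ (range x' ∪ range (cexp ∘ x')))) :
    (m : Cardinal) ≤ Algebra.trdeg ℚ ↥(IntermediateField.adjoin ℚ (range x ∪ range (cexp ∘ x))) := by
  classical
  set v : Fin n ⊕ Fin n → ℂ := Sum.elim x (cexp ∘ x) with hv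
  set v' : Fin n ⊕ Fin n → ℂ := Sum.elim x' (cexp ∘ x') with hv'
  have hS : range x ∪ range (cexp ∘ x) = range v := by rw [hv, Set.Sum.elim_range]
  have hS' : range x' ∪ range (cexp ∘ x') = range v' := by rw [hv', Set.Sum.elim_range]
  rw [hS] at ⊢
  rw [hS'] at hm
  -- an independent subset `J` of `range v'` of size `m`
  have hm' : (m : ℕ∞) ≤ (GammaField.algMatroid ℂ).eRk (range v') :=
    ZilberHomogeneity.natCast_le_eRk_of_le_trdeg hm
  obtain ⟨J, hJsub, hJind, hJcard⟩ := Matroid.le_eRk_iff.1 hm'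
  -- index it
  have hpre : ∀ j : J, ∃ i : Fin n ⊕ Fin n, v' i = (j : ℂ) := fun j => hJsub j.2
  choose f hf using hpre
  have hvf : v' ∘ f = (Subtype.val : J → ℂ) := funext hf
  have hJind' : AlgebraicIndependent ℚ (v' ∘ f) := by
    rw [hvf]
    exact (AlgebraicIndependent.matroid_indep_iff.1 hJind)
  -- transfer to `v`
  have hind : AlgebraicIndependent ℚ (v ∘ f) := algebraicIndependent_of_relations hrel f hJind'
  have hinj : Function.Injective (v ∘ f) := hind.injective
  have hI : (GammaField.algMatroid ℂ).Indep (range (v ∘ f)) :=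
    AlgebraicIndependent.matroid_indep_iff.2 hind.to_subtype_range
  have hIsub : range (v ∘ f) ⊆ range v := by
    rintro a ⟨j, rfl⟩; exact ⟨f j, rfl⟩
  have hcard : (range (v ∘ f)).encard = m := by
    rw [← hJcard, ← Set.image_univ, hinj.encard_image, Set.encard_univ]
    simp
  have hle : (m : ℕ∞) ≤ (GammaField.algMatroid ℂ).eRk (range v) := by
    rw [← hcard]; exact hI.encard_le_eRk_of_subset hIsub
  exact le_trdeg_adjoin_of_natCast_le_eRk hle


/-- At a first-failure rank, an LI mate `x'` has an algebraically independent sub-family of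
`(x', e^{x'})` of size `n − 1`, indexed injectively. [folklore] -/
theorem exists_indep_subfamily {n : ℕ} {x' : Fin n → ℂ} (hli : LinearIndependent ℚ x')
    (hrank : ∀ r < n, SchanuelRank r) :
    ∃ f : Fin (n - 1) → Fin n ⊕ Fin n, AlgebraicIndependent ℚ (Sum.elim x' (cexp ∘ x') ∘ f) := by
  classical
  set v' : Fin n ⊕ Fin n → ℂ := Sum.elim x' (cexp ∘ x') with hv'
  have hS' : range x' ∪ range (cexp ∘ x') = range v' := by rw [hv', Set.Sum.elim_range]
  have hm : ((n - 1 : ℕ) : Cardinal) ≤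
      Algebra.trdeg ℚ ↥(IntermediateField.adjoin ℚ (range x' ∪ range (cexp ∘ x'))) :=
    pred_le_trdeg_of_ranks_below hli hrank
  rw [hS'] at hm
  have hm' : ((n - 1 : ℕ) : ℕ∞) ≤ (GammaField.algMatroid ℂ).eRk (range v') :=
    ZilberHomogeneity.natCast_le_eRk_of_le_trdeg hm
  obtain ⟨J, hJsub, hJind, hJcard⟩ := Matroid.le_eRk_iff.1 hm'
  have hpre : ∀ j : J, ∃ i : Fin n ⊕ Fin n, v' i = (j : ℂ) := fun j => hJsub j.2
  choose f hf using hpre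
  have hvf : v' ∘ f = (Subtype.val : J → ℂ) := funext hf
  have hJind' : AlgebraicIndependent ℚ (v' ∘ f) := by
    rw [hvf]; exact AlgebraicIndependent.matroid_indep_iff.1 hJind
  -- reindex `J ≃ Fin (n-1)`
  have hfin : J.Finite := Set.finite_of_encard_eq_coe hJcard
  haveI : Fintype J := hfin.fintype
  have hcardJ : Fintype.card J = n - 1 := by
    have h := hJcard
    rw [Set.encard_eq_coe_toFinset_card, Set.toFinset_card] at h
    exact_mod_cast h
  let e : Fin (n - 1) ≃ J := (Fintype.equivFinOfCardEq hcardJ).symm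
  refine ⟨f ∘ e, ?_⟩
  have : v' ∘ (f ∘ e) = (v' ∘ f) ∘ e := rfl
  rw [this]
  exact hJind'.comp _ e.injective

/-- (dev copy of `mate_trdeg_lt`) [folklore] -/
theorem mate_trdeg_lt' {n : ℕ} {x x' : Fin n → ℂ}
    (htr : Algebra.trdeg ℚ ↥(IntermediateField.adjoin ℚ (range x ∪ range (cexp ∘ x))) < (n : Cardinal))
    (hrel : ∀ p : MvPolynomial (Fin n ⊕ Fin n) ℚ,
      MvPolynomial.aeval (Sum.elim x (cexp ∘ x)) p = 0 →
      MvPolynomial.aeval (Sum.elim x' (cexp ∘ x')) p = 0) :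
    Algebra.trdeg ℚ ↥(IntermediateField.adjoin ℚ (range x' ∪ range (cexp ∘ x'))) < (n : Cardinal) := by
  by_contra h
  exact (not_le.2 htr) (natCast_le_trdeg_of_relations hrel (not_lt.1 h))

/-- **The locus of a mate is the locus** (second half of `stub_mateFirstFailure`): if `x'` is a
ℚ-linearly independent tuple satisfying every ℚ-relation of a first failure `x`, then conversely `x`
satisfies every ℚ-relation of `x'` — the relation ideals coincide.  (Prime ideals `P ⊆ P'` of
`ℚ[X, Y]` whose quotients `ℚ[x, eˣ] ↠ ℚ[x', e^{x'}]` have the same transcendence degree `n − 1` are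
equal: lift an algebraically independent `(n−1)`-sub-family `v' ∘ f` to `v ∘ f`; a relation `p` of `x'`
evaluates at `(x, eˣ)` to an element `a` algebraic over `ℚ[v ∘ f]`, with a relation of non-zero constant
term `g₀(v ∘ f)` if `a ≠ 0`; transporting that relation along `P ⊆ P'` kills `g₀(v' ∘ f)`, so `g₀ = 0`.)
[cite: Kirby2010, §1] -/
theorem mate_relations_symm {n : ℕ} {x x' : Fin n → ℂ}
    (hx : LinearIndependent ℚ x ∧
      Algebra.trdeg ℚ ↥(IntermediateField.adjoin ℚ (range x ∪ range (cexp ∘ x))) < (n : Cardinal) ∧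
      ∀ r < n, SchanuelRank r)
    (hx' : LinearIndependent ℚ x' ∧ ∀ p : MvPolynomial (Fin n ⊕ Fin n) ℚ,
      MvPolynomial.aeval (Sum.elim x (cexp ∘ x)) p = 0 →
      MvPolynomial.aeval (Sum.elim x' (cexp ∘ x')) p = 0)
    (p : MvPolynomial (Fin n ⊕ Fin n) ℚ)
    (hp : MvPolynomial.aeval (Sum.elim x' (cexp ∘ x')) p = 0) :
    MvPolynomial.aeval (Sum.elim x (cexp ∘ x)) p = 0 := by
  classical
  set v : Fin n ⊕ Fin n → ℂ := Sum.elim x (cexp ∘ x) with hv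
  set v' : Fin n ⊕ Fin n → ℂ := Sum.elim x' (cexp ∘ x') with hv'
  have hrel : ∀ q : MvPolynomial (Fin n ⊕ Fin n) ℚ,
      MvPolynomial.aeval v q = 0 → MvPolynomial.aeval v' q = 0 := hx'.2
  have hn : 1 ≤ n := le_trans (by norm_num) (firstFailure_two_le hx.1 hx.2.1)
  -- an independent `(n-1)`-sub-family of `v'`, pulled back to `v`
  obtain ⟨f, hf'⟩ := exists_indep_subfamily hx'.1 hx.2.2
  have hf : AlgebraicIndependent ℚ (v ∘ f) := algebraicIndependent_of_relations hrel f hf'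
  set a : ℂ := MvPolynomial.aeval v p with ha
  by_contra ha0
  set B : Subalgebra ℚ ℂ := Algebra.adjoin ℚ (range (v ∘ f)) with hB
  -- Step A: `a` is algebraic over `B` (`(a, v ∘ f)` are `n` elements of `ℚ(x, eˣ)`, `trdeg < n`)
  have halg : IsAlgebraic B a := by
    by_contra htr
    have hind : AlgebraicIndependent ℚ (fun o : Option (Fin (n - 1)) => o.elim a (v ∘ f)) :=
      AlgebraicIndependent.option_iff.2 ⟨hf, htr⟩
    set K := IntermediateField.adjoin ℚ (range x ∪ range (cexp ∘ x)) with hK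
    have hvK : ∀ i, v i ∈ K := by
      rintro (i | i)
      · exact IntermediateField.subset_adjoin ℚ _ (Or.inl ⟨i, rfl⟩)
      · exact IntermediateField.subset_adjoin ℚ _ (Or.inr ⟨i, rfl⟩)
    have haK : a ∈ K := by
      rw [ha, MvPolynomial.aeval_def, MvPolynomial.eval₂_eq]
      refine sum_mem fun m _ => mul_mem ?_ (prod_mem fun i _ => pow_mem (hvK i) _)
      exact (algebraMap ℚ K (p.coeff m)).2
    have hmemK : ∀ o : Option (Fin (n - 1)), (o.elim a (v ∘ f) : ℂ) ∈ K := by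
      rintro (_ | i)
      · exact haK
      · exact hvK (f i)
    let w : Option (Fin (n - 1)) → K := fun o => ⟨o.elim a (v ∘ f), hmemK o⟩
    have hw : AlgebraicIndependent ℚ w := AlgebraicIndependent.of_comp K.val hind
    have hle := hw.cardinalMk_le_trdeg
    have hcard : Cardinal.mk (Option (Fin (n - 1))) = (n : Cardinal) := by
      rw [Cardinal.mk_option, Cardinal.mk_fin]
      have : ((n - 1 : ℕ) : Cardinal) + 1 = ((n - 1 + 1 : ℕ) : Cardinal) := by push_cast; rfl
      rw [this, Nat.sub_add_cancel hn]
    rw [hcard] at hle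
    exact (not_le.2 hx.2.1) hle
  -- Step B: a relation of `a` over `B` with non-zero constant term
  obtain ⟨q, hq0, hqa⟩ := halg
  obtain ⟨q₁, hq₁, hndvd⟩ := Polynomial.exists_eq_pow_rootMultiplicity_mul_and_not_dvd q hq0 0
  have hq₁0 : q₁.coeff 0 ≠ 0 := by
    intro h0
    apply hndvd
    rw [map_zero, sub_zero]
    exact Polynomial.X_dvd_iff.2 h0
  have hq₁a : Polynomial.aeval a q₁ = 0 := by
    have h := hqa
    rw [hq₁, map_mul, map_pow, map_sub, Polynomial.aeval_X, Polynomial.aeval_C, map_zero,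
      sub_zero] at h
    exact (mul_eq_zero.1 h).resolve_left (pow_ne_zero _ ha0)
  -- Step C: coefficients of `q₁` as polynomials in `v ∘ f`
  have hcoef : ∀ j : ℕ, ∃ g : MvPolynomial (Fin (n - 1)) ℚ,
      MvPolynomial.aeval (v ∘ f) g = ((q₁.coeff j : B) : ℂ) := by
    intro j
    have hmem : ((q₁.coeff j : B) : ℂ) ∈ Algebra.adjoin ℚ (range (v ∘ f)) := (q₁.coeff j).2
    rw [Algebra.adjoin_range_eq_range_aeval] at hmem
    obtain ⟨g, hg⟩ := hmem
    exact ⟨g, hg⟩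
  choose g hg using hcoef
  -- Step D: the transported relation `G := Σ_j (rename f g_j) · p^j`
  set N := q₁.natDegree + 1 with hN
  set G : MvPolynomial (Fin n ⊕ Fin n) ℚ :=
    ∑ j ∈ Finset.range N, MvPolynomial.rename f (g j) * p ^ j with hG
  have hGv : MvPolynomial.aeval v G = Polynomial.aeval a q₁ := by
    rw [Polynomial.aeval_eq_sum_range, hG, map_sum]
    refine Finset.sum_congr rfl fun j _ => ?_
    rw [map_mul, map_pow, MvPolynomial.aeval_rename, hg j, Algebra.smul_def]
    rfl
  have hG0 : MvPolynomial.aeval v G = 0 := by rw [hGv, hq₁a]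
  have hG0' : MvPolynomial.aeval v' G = 0 := hrel G hG0
  have hpv' : MvPolynomial.aeval v' p = 0 := hp
  have hGv' : MvPolynomial.aeval v' G = MvPolynomial.aeval (v' ∘ f) (g 0) := by
    rw [hG, map_sum, Finset.sum_eq_single 0]
    · rw [map_mul, pow_zero, map_one, mul_one, MvPolynomial.aeval_rename]
    · intro j _ hj
      rw [map_mul, map_pow, hpv', zero_pow hj, mul_zero]
    · intro h
      exact absurd (Finset.mem_range.2 (by rw [hN]; omega)) h
  have hg0 : g 0 = 0 := by
    apply algebraicIndependent_iff.1 hf'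
    rw [← hGv']
    exact hG0'
  apply hq₁0
  have hc : ((q₁.coeff 0 : B) : ℂ) = 0 := by rw [← hg 0, hg0, map_zero]
  exact_mod_cast hc

/-- Hence **the locus of a mate is the locus** as sets: the registered set-equality conjunct of
`stub_mateFirstFailure`. [cite: Kirby2010, §1] -/
theorem mate_locus_eq {n : ℕ} {x x' : Fin n → ℂ}
    (hx : LinearIndependent ℚ x ∧
      Algebra.trdeg ℚ ↥(IntermediateField.adjoin ℚ (range x ∪ range (cexp ∘ x))) < (n : Cardinal) ∧
      ∀ r < n, SchanuelRank r)
    (hx' : LinearIndependent ℚ x' ∧ ∀ p : MvPolynomial (Fin n ⊕ Fin n) ℚ,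
      MvPolynomial.aeval (Sum.elim x (cexp ∘ x)) p = 0 →
      MvPolynomial.aeval (Sum.elim x' (cexp ∘ x')) p = 0) :
    {x'' : Fin n → ℂ | ∀ p : MvPolynomial (Fin n ⊕ Fin n) ℚ,
        MvPolynomial.aeval (Sum.elim x' (cexp ∘ x')) p = 0 →
        MvPolynomial.aeval (Sum.elim x'' (cexp ∘ x'')) p = 0} =
    {x'' : Fin n → ℂ | ∀ p : MvPolynomial (Fin n ⊕ Fin n) ℚ,
        MvPolynomial.aeval (Sum.elim x (cexp ∘ x)) p = 0 →
        MvPolynomial.aeval (Sum.elim x'' (cexp ∘ x'')) p = 0} := by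
  ext x''
  simp only [mem_setOf_eq]
  constructor
  · intro h p hp
    exact h p (hx'.2 p hp)
  · intro h p hp
    exact h p (mate_relations_symm hx hx' p hp)

/-- **`stub_mateFirstFailure` of the PICKED line `kernel-arithmetic-selection`, VERBATIM, proved.**
[cite: Kirby2010, §1] -/
theorem stub_mateFirstFailure_holds : ∀ (n : ℕ) (x x' : Fin n → ℂ), (LinearIndependent ℚ x ∧ Algebra.trdeg ℚ ↥(IntermediateField.adjoin ℚ (Set.range x ∪ Set.range (Complex.exp ∘ x))) < (n : Cardinal) ∧ ∀ r < n, Literature.NumberTheory.Transcendental.SchanuelRank r) → (LinearIndependent ℚ x' ∧ ∀ p : MvPolynomial (Fin n ⊕ Fin n) ℚ, MvPolynomial.aeval (Sum.elim x (Complex.exp ∘ x)) p = 0 → MvPolynomial.aeval (Sum.elim x' (Complex.exp ∘ x')) p = 0) → (LinearIndependent ℚ x' ∧ Algebra.trdeg ℚ ↥(IntermediateField.adjoin ℚ (Set.range x' ∪ Set.range (Complex.exp ∘ x'))) < (n : Cardinal) ∧ ∀ r < n, Literature.NumberTheory.Transcendental.SchanuelRank r) ∧ {x'' : Fin n → ℂ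 | ∀ p : MvPolynomial (Fin n ⊕ Fin n) ℚ, MvPolynomial.aeval (Sum.elim x' (Complex.exp ∘ x')) p = 0 → MvPolynomial.aeval (Sum.elim x'' (Complex.exp ∘ x'')) p = 0} = {x'' : Fin n → ℂ | ∀ p : MvPolynomial (Fin n ⊕ Fin n) ℚ, MvPolynomial.aeval (Sum.elim x (Complex.exp ∘ x)) p = 0 → MvPolynomial.aeval (Sum.elim x'' (Complex.exp ∘ x'')) p = 0} :=
  fun _ _ _ hx hx' => ⟨⟨hx'.1, mate_trdeg_lt' hx.2.1 hx'.2, hx.2.2⟩, mate_locus_eq hx hx'⟩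

end Summit.Schanuel.Schanuel.Cruxes.MinimalCounterexampleInAcl.StubsEvidence3

end
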